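import Mathlib.Combinatorics.Configuration
import Mathlib.GroupTheory.SpecificGroups.Cyclic
import HarnessLib

/-!
# Collineation groups of a putative projective plane of order 12 — the printed floor

Typed statements (named facts, not proved here) of the published restrictions on the collineation
group of a hypothetical projective plane of order 12, in the vocabulary of Mathlib's abstract
projective planes (`Configuration.ProjectivePlane P L`, `ProjectivePlane.order`). A *collineation
group* is taken abstractly as a finite group acting on points and on lines, faithfully on points,
preserving incidence (`IsCollineationGroup`) — this is the setting of the cited papers (a subgroup of
the full collineation group acts this way, and conversely such an action embeds `G` into it).

* (not typed separately: Akiyama–Suetake–Tanaka 2019, Theorem (p. 114): "There are no projective planes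
  of order 12 admitting a collineation group of order 9" — it is the last input of the Corollary below.)
* `CollineationGroupCyclicOrderDvd` — Akiyama–Suetake–Tanaka 2019, Corollary (p. 114, from the
  Theorem and Akiyama–Suetake 2008): "If `G` is a collineation group of a projective plane `π` of
  order 12, then `G` is cyclic and `|G|` divides 3 or 4."
* `NoCollineationGroupOfOrderFour` — Akiyama–Suetake–Tanaka 2023 (title theorem): "Projective planes
  of order 12 do not have a collineation group of order 4."

Earlier links of the chain (Janko–van Trung 1981–82: `{2,3}`-group, no Klein four-group, order-4
groups cyclic, groups of order 3 or 4 are not elation groups; Horvatić-Baldasar–Kramer–Matulić-Bedenić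
1986/87; Suetake 2004; Akiyama–Suetake 2008, 2009) are summarised in AST 2019 §1 (p. 113, items
(i)–(iv)) and are implied, as far as group orders go, by the two facts below. Consequence used by
the census cell `pub-namedobj` (target M, family B1; derived on the Summits side, not here): a
collineation group of a projective plane of order 12 has order 1, 2 or 3.

## References
* K. Akiyama, C. Suetake, M. Tanaka, *The nonexistence of projective planes of order 12 with a
  collineation group of order 9*, Australas. J. Combin. 74(1) (2019) 112–160. [AkiyamaSuetakeTanaka2019]
* K. Akiyama, C. Suetake, M. Tanaka, *Projective planes of order 12 do not have a collineation group
  of order 4*, J. Combin. Des. 31 (2023) 87–123, doi:10.1002/jcd.21869. [AkiyamaSuetakeTanaka2023]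
-/

namespace Literature.Combinatorics.Designs

open Configuration

/-- `G` is a (finite, abstract) collineation group of the incidence structure `(P, L)`: it acts on
points and on lines, faithfully on points, and preserves incidence (AST 2019 §2, standard).
[cite: AkiyamaSuetakeTanaka2019, §2 Preliminaries p. 114] -/
def IsCollineationGroup (G P L : Type*) [Group G] [Membership P L] [MulAction G P]
    [MulAction G L] : Prop :=
  FaithfulSMul G P ∧ ∀ (g : G) (p : P) (l : L), p ∈ l ↔ g • p ∈ g • l

/-- **Akiyama–Suetake–Tanaka 2019, Corollary.** "If `G` is a collineation group of a projective
plane `π` of order 12, then `G` is cyclic and `|G|` divides 3 or 4." Named fact (it rests on the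
whole Janko–van Trung / Suetake / Akiyama–Suetake chain; not proved here).
[cite: AkiyamaSuetakeTanaka2019, Corollary p. 114] -/
def CollineationGroupCyclicOrderDvd : Prop :=
  ∀ (P L : Type) [Membership P L] [Fintype P] [Fintype L] [ProjectivePlane P L],
    ProjectivePlane.order P L = 12 →
    ∀ (G : Type) [Group G] [Fintype G] [MulAction G P] [MulAction G L],
      IsCollineationGroup G P L → IsCyclic G ∧ (Fintype.card G ∣ 3 ∨ Fintype.card G ∣ 4)

/-- **Akiyama–Suetake–Tanaka 2023.** "Projective planes of order 12 do not have a collineation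
group of order 4." Named fact (computer-assisted; not proved here).
[cite: AkiyamaSuetakeTanaka2023, Theorem (title result) p. 87] -/
def NoCollineationGroupOfOrderFour : Prop :=
  ∀ (P L : Type) [Membership P L] [Fintype P] [Fintype L] [ProjectivePlane P L],
    ProjectivePlane.order P L = 12 →
    ∀ (G : Type) [Group G] [Fintype G] [MulAction G P] [MulAction G L],
      IsCollineationGroup G P L → Fintype.card G ≠ 4

end Literature.Combinatorics.Designs

namespace Literature.Combinatorics.Designs

open Configuration

/-- **Janko–van Trung 1982 (title theorem).** "The full collineation group of any projective plane of
order 12 is a {2,3}-group." Typed for an abstract collineation group `G` (which embeds in the full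
collineation group, so every prime divisor of `|G|` divides the order of the full group): every prime
dividing `|G|` is `2` or `3`; in particular a projective plane of order 12 has no collineation of order
`5`, `7`, `11`, `13` or `157`. Named fact (the cases `p = 11, 13` are computer-assisted in the source and its
companions; not proved here — the cell `pub-namedobj` re-derives the `p = 11` slice independently under
`Summits/Ventures/DiscreteObjects/PP12/`, which is NOT this fact). As far as group orders go it is implied by
`CollineationGroupCyclicOrderDvd` (AST 2019); it is recorded separately because it is the printed statement
the census control C−M3 reproduces. [cite: JankoVanTrung1982, Theorem (title result) p. 101] -/
def CollineationGroupIsTwoThreeGroup : Prop :=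
  ∀ (P L : Type) [Membership P L] [Fintype P] [Fintype L] [ProjectivePlane P L],
    ProjectivePlane.order P L = 12 →
    ∀ (G : Type) [Group G] [Fintype G] [MulAction G P] [MulAction G L],
      IsCollineationGroup G P L → ∀ p : ℕ, p.Prime → p ∣ Fintype.card G → p = 2 ∨ p = 3

end Literature.Combinatorics.Designs
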